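import Summits.AnomalousDissipation.AnomalousDissipation.Theorems.ImpulseGridGridInjectionIdentity
import Summits.AnomalousDissipation.AnomalousDissipation.Theorems.ImpulseGridGridThesisStubLaplacianPairingBound
import Summits.AnomalousDissipation.AnomalousDissipation.Theorems.ImpulseGridGridSignsStubKickInjectionIdentity
import Summits.AnomalousDissipation.AnomalousDissipation.Theorems.ImpulseGridGridSignsStubSlabFactorization
import Summits.AnomalousDissipation.AnomalousDissipation.Theorems.ImpulseGridGridSignsStubCeilingsYoungBound

/-!
# Crux `GridSigns` (stmt-AnomalousDissipation-1771) — QUIET WAKES give `GridSigns` (ceilings transfer)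

Transfer theorem of line `SketchIdeator2` (card `shape-constant-split`, lead c1): the existence
hypothesis of the line — a slab⊗transverse design with a window weight `χ ≥ 0`, a kick test
function `H ≥ 0` (`∂₀H = χ − Φ`), a positive KICK MARGIN
`(∫ΦH)‖G‖₂² − (a/2)(∫χ‖G‖² + ‖G‖₂²) − (c²/2a)(δχ+δb) − Gmax(δχ+δΦ) − L·δH ≥ 2η`, and a
vanishing-viscosity drift Leray–Hopf family with per-`j` sup-energy bounds, `ν`-uniformly bounded
mean energy, NO REVERSAL `Λ⟨(G,uⱼ)⟩ ≥ 0` and the four wake-energy CEILINGS (window, slab, arc,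
bulk) — implies the crux `GridSigns` (`gridSigns_of_quietWakes`). Ingredients, all landed:
`detunedWorkIdentity` (here; = `GridInjectionIdentity` (1) rearranged), the kick formula
`stub_kickInjectionIdentity` (p114982), the factorization `stub_slabFactorization` (p114681), the
Young/strain ceilings `stub_ceilingsYoungBound` (p115804) and the Laplacian pairing bound
`stub_laplacianPairingBound`; the `O(ν)` terms are absorbed by a tail shift `j ↦ j + J`.
The hypothesis is the registered stub `stub_quietWakes` of the line verbatim (conjecture-grade:
with `boundedEnergyGrid_of_gridSigns` every witness is a bounded-energy fixed-force family with an
injection floor). No new definitions.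
-/

noncomputable section

-- `Summit.<Summit>.<Problem>` is the tree's mandated summit-side namespace (CONVENTIONS §2); for this
-- single-conjunct summit the two coincide, so the duplicate is deliberate.
set_option linter.dupNamespace false

open MeasureTheory Set Filter Topology
open scoped InnerProductSpace RealInnerProductSpace

namespace Summit.AnomalousDissipation.AnomalousDissipation.Theorems.GridSignsCeilings

open Literature.Analysis
open Literature.Analysis.FluidPDE Literature.Analysis.FluidPDE.Torus
open Literature.Analysis.FunctionSpaces Literature.Analysis.FunctionSpaces.Torus
open Summit.AnomalousDissipation.AnomalousDissipation.Theses.ImpulseGrid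

/-- **Early relaxation is detuned work** (card shape-constant-split, first lemma; split form).
For the grid design and a global Leray–Hopf flow with sup-bounded kinetic energy, the
`Ψ•G`-tested mean momentum balance reads
`Λ⟨∫⟪w,(w·∇)(Ψ•G)⟫⟩ = −c·(Λ⟨(Φ•G,u)⟩ − Λ⟨(G,u)⟩) − ν·Λ⟨(u,Δ(Ψ•G))⟩`, `w = u − c e₀`: the sign
condition (b) of `GridSigns` says that the Doppler-DETUNED part `(Φ−1)G` of the force does work
`≥ η/c` up to `O(ν)` (rearrangement of the landed `GridInjectionIdentity` (1) with
`∫ΦΨ|G|² = 0`). [folklore] -/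
theorem detunedWorkIdentity :
    ∀ (Λ : GeneralizedLimit) (ν c : ℝ) (Φ Ψ : UnitAddTorus (Fin 3) → ℝ)
      (G : UnitAddTorus (Fin 3) → EuclideanSpace ℝ (Fin 3))
      (u₀ : UnitAddTorus (Fin 3) → EuclideanSpace ℝ (Fin 3))
      (u : ℝ → UnitAddTorus (Fin 3) → EuclideanSpace ℝ (Fin 3)),
      0 < ν → IsSmooth Φ → IsSmooth Ψ → IsSmooth G →
      (∀ (s : UnitAddCircle) x, Ψ (x + Pi.single (1 : Fin 3) s) = Ψ x ∧ Ψ (x + Pi.single (2 : Fin 3) s) = Ψ x) →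
      (∀ (s : UnitAddCircle) x, G (x + Pi.single (0 : Fin 3) s) = G x) → (∀ x, G x 0 = 0) → IsDivFree G →
      (∀ x, Torus.partialDeriv 0 Ψ x = Φ x - 1) → (∫ x, Φ x * Ψ x * ‖G x‖ ^ 2 = 0) →
      IsGlobalLerayHopf ν (fun _ => fun x => Φ x • G x) u₀ u →
      (∃ C : ℝ, ∀ t : ℝ, 0 ≤ t → kineticEnergy (u t) ≤ C) →
      Λ.longTimeAvg (fun t => ∫ x, ⟪u t x - c • EuclideanSpace.single 0 1,
          Torus.convect (fun y => u t y - c • EuclideanSpace.single 0 1) (fun y => Ψ y • G y) x⟫)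
        = -c * (Λ.longTimeAvg (fun t => ∫ x, ⟪Φ x • G x, u t x⟫)
                  - Λ.longTimeAvg (fun t => ∫ x, ⟪G x, u t x⟫))
          - ν * Λ.longTimeAvg (fun t => ∫ x, ⟪u t x, Torus.laplacian (fun y => Ψ y • G y) x⟫) := by
  intro Λ ν c Φ Ψ G u₀ u hν hΦ hΨ hG hΨinv hGinv hG0 hGdiv hΨ' hnorm hu hE
  have hI := (impulseGrid_gridInjectionIdentity Λ ν c Φ Ψ G u₀ u hν hΦ hΨ hG hΨinv hGinv hG0 hGdiv hΨ'
    hu hE).1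
  rw [hnorm] at hI
  linarith

/-- **Quiet wakes give `GridSigns`** (line `SketchIdeator2`, ceilings transfer): the line's
existence hypothesis (registered stub `stub_quietWakes`, verbatim) implies the crux. For each `j`,
`(b)ⱼ = −c(Λ(ΦG,uⱼ) − Λ(G,uⱼ)) − νⱼΛ(uⱼ,Δ(ΨG))` (detuned work), the kick formula and the ceilings
give `(b)ⱼ ≤ −2η + νⱼ·K` with `K = (‖Δ(ΨG)‖_∞ + ‖Δ(HG)‖_∞)(1 + E)/2`; along the tail `j ≥ J`
(`νⱼ K ≤ η`) this is `≤ −η`, and (a), the drift data and the energy bound are copied. [folklore] -/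
theorem gridSigns_of_quietWakes :
    (∃ (Φ Ψ χ H : UnitAddTorus (Fin 3) → ℝ) (G : UnitAddTorus (Fin 3) → EuclideanSpace ℝ (Fin 3))
      (c a Gmax L δχ δΦ δH δb η : ℝ),
      IsSmooth Φ ∧ IsSmooth Ψ ∧ IsSmooth G ∧
      (∀ (s : UnitAddCircle) x, Ψ (x + Pi.single (1 : Fin 3) s) = Ψ x ∧ Ψ (x + Pi.single (2 : Fin 3) s) = Ψ x) ∧
      (∀ (s : UnitAddCircle) x, G (x + Pi.single (0 : Fin 3) s) = G x) ∧ (∀ x, G x 0 = 0) ∧ IsDivFree G ∧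
      (∀ x, Torus.partialDeriv 0 Ψ x = Φ x - 1) ∧ (∫ x, Φ x * Ψ x * ‖G x‖ ^ 2 = 0) ∧
      IsSmooth (fun x => Φ x • G x) ∧ IsDivFree (fun x => Φ x • G x) ∧ HasZeroMean (fun x => Φ x • G x) ∧
      IsSmooth χ ∧ IsSmooth H ∧
      (∀ (s : UnitAddCircle) x, Φ (x + Pi.single (1 : Fin 3) s) = Φ x ∧ Φ (x + Pi.single (2 : Fin 3) s) = Φ x) ∧
      (∀ (s : UnitAddCircle) x, H (x + Pi.single (1 : Fin 3) s) = H x ∧ H (x + Pi.single (2 : Fin 3) s) = H x) ∧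
      (∀ x, 0 ≤ Φ x) ∧ (∀ x, 0 ≤ χ x) ∧ (∀ x, 0 ≤ H x) ∧ (∀ x, Torus.partialDeriv 0 H x = χ x - Φ x) ∧
      (∀ x, ‖G x‖ ≤ Gmax) ∧
      (∀ x (v : EuclideanSpace ℝ (Fin 3)), |⟪v, Torus.convect (fun _ => v) G x⟫| ≤ L * ‖v‖ ^ 2) ∧
      0 < c ∧ 0 < a ∧ 0 < η ∧
      2 * η ≤ (∫ x, Φ x * H x) * (∫ x, ‖G x‖ ^ 2) - (a / 2) * ((∫ x, χ x * ‖G x‖ ^ 2) + ∫ x, ‖G x‖ ^ 2)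
          - (c ^ 2 / (2 * a)) * (δχ + δb) - Gmax * (δχ + δΦ) - L * δH ∧
      ∃ (ν : ℕ → ℝ) (u₀ : ℕ → UnitAddTorus (Fin 3) → EuclideanSpace ℝ (Fin 3))
        (u : ℕ → ℝ → UnitAddTorus (Fin 3) → EuclideanSpace ℝ (Fin 3)) (Λ : GeneralizedLimit),
        (∀ j, 0 < ν j) ∧ Tendsto ν atTop (nhds 0) ∧
        (∀ j, IsGlobalLerayHopf (ν j) (fun _ => fun x => Φ x • G x) (u₀ j) (u j)) ∧
        (∀ j, ∃ C : ℝ, ∀ t : ℝ, 0 ≤ t → kineticEnergy (u j t) ≤ C) ∧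
        (∀ j, ∫ x, u₀ j x = c • EuclideanSpace.single 0 1) ∧
        (∃ E : ℝ, ∀ j, meanEnergy (u j) ≤ E) ∧
        (∀ j, 0 ≤ Λ.longTimeAvg (fun t => ∫ x, ⟪G x, u j t x⟫)) ∧
        (∀ j, Λ.longTimeAvg (fun t => ∫ x, χ x * ‖u j t x - c • EuclideanSpace.single 0 1‖ ^ 2) ≤ δχ) ∧
        (∀ j, Λ.longTimeAvg (fun t => ∫ x, Φ x * ‖u j t x - c • EuclideanSpace.single 0 1‖ ^ 2) ≤ δΦ) ∧
        (∀ j, Λ.longTimeAvg (fun t => ∫ x, H x * ‖u j t x - c • EuclideanSpace.single 0 1‖ ^ 2) ≤ δH) ∧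
        (∀ j, Λ.longTimeAvg (fun t => ∫ x, ‖u j t x - c • EuclideanSpace.single 0 1‖ ^ 2) ≤ δb)) →
    GridSigns := by
  intro hQ
  obtain ⟨Φ, Ψ, χ, H, G, c, a, Gmax, L, δχ, δΦ, δH, δb, η, hΦ, hΨ, hG, hΨinv, hGinv, hG0, hGdiv,
    hΨ', hnorm, hf1, hf2, hf3, hχ, hH, hΦinv, hHinv, hΦnn, hχnn, hHnn, hH', hGmax, hL, hc, ha, hη,
    hmargin, ν, u₀, u, Λ, hν, hν0, hLH, hsup, hmom, ⟨E₀, hE₀⟩, hares, hcχ, hcΦ, hcH, hcb⟩ :=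
    hQ
  -- the free kick factorizes (S2b)
  have hfact : ∫ x, Φ x * H x * ‖G x‖ ^ 2 = (∫ x, Φ x * H x) * ∫ x, ‖G x‖ ^ 2 :=
    stub_slabFactorization (fun x => Φ x * H x) G (hΦ.continuous.mul hH.continuous) hG.continuous
      (fun s x => ⟨by rw [(hΦinv s x).1, (hHinv s x).1], by rw [(hΦinv s x).2, (hHinv s x).2]⟩) hGinv
  -- a nonnegative energy ceiling
  set E : ℝ := max E₀ 0 with hEdef
  have hE : ∀ j, meanEnergy (u j) ≤ E := fun j => (hE₀ j).trans (le_max_left _ _)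
  have hEnn : 0 ≤ E := le_max_right _ _
  -- uniform bounds on the two Laplacian pairings
  have hV : IsSmooth (fun y => Ψ y • G y) := hΨ.smul' hG
  have hW : IsSmooth (fun y => H y • G y) := hH.smul' hG
  obtain ⟨MΨ, hMΨ0, hMΨ⟩ :=
    FluidPDE.Torus.exists_nonneg_forall_norm_le_of_continuous hV.laplacian.continuous
  obtain ⟨MH, hMH0, hMH⟩ :=
    FluidPDE.Torus.exists_nonneg_forall_norm_le_of_continuous hW.laplacian.continuous
  set K : ℝ := (MΨ + MH) * (1 + E) / 2 with hKdef
  have hK : 0 ≤ K := by positivity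
  have hLΨ : ∀ j, |Λ.longTimeAvg (fun t => ∫ x, ⟪u j t x, Torus.laplacian (fun y => Ψ y • G y) x⟫)|
      ≤ MΨ * (1 + E) / 2 := fun j => by
    have h := stub_laplacianPairingBound Λ (ν j) MΨ (fun x => Φ x • G x) (fun y => Ψ y • G y) (u₀ j)
      (u j) hV hMΨ (hLH j) (hsup j)
    have h2 : MΨ * (1 + meanEnergy (u j)) / 2 ≤ MΨ * (1 + E) / 2 := by
      have := hE j
      gcongr
    exact h.trans h2
  have hLHp : ∀ j, |Λ.longTimeAvg (fun t => ∫ x, ⟪u j t x, Torus.laplacian (fun y => H y • G y) x⟫)|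
      ≤ MH * (1 + E) / 2 := fun j => by
    have h := stub_laplacianPairingBound Λ (ν j) MH (fun x => Φ x • G x) (fun y => H y • G y) (u₀ j)
      (u j) hW hMH (hLH j) (hsup j)
    have h2 : MH * (1 + meanEnergy (u j)) / 2 ≤ MH * (1 + E) / 2 := by
      have := hE j
      gcongr
    exact h.trans h2
  -- choose the tail: `ν j · K ≤ η` for `j ≥ J`
  have hε : 0 < η / (K + 1) := by positivity
  obtain ⟨J, hJ⟩ := eventually_atTop.1 (hν0.eventually (gt_mem_nhds hε))
  have hsmall : ∀ j, J ≤ j → ν j * K ≤ η := by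
    intro j hj
    have h1 : ν j < η / (K + 1) := hJ j hj
    have h2 : ν j * K ≤ ν j * (K + 1) := mul_le_mul_of_nonneg_left (by linarith) (hν j).le
    have h3 : ν j * (K + 1) < η / (K + 1) * (K + 1) := mul_lt_mul_of_pos_right h1 (by linarith)
    have h4 : η / (K + 1) * (K + 1) = η := by field_simp
    linarith
  -- nonnegativity of the ceiling coefficients
  have hGmax0 : 0 ≤ Gmax := (norm_nonneg _).trans (hGmax 0)
  have hL0 : 0 ≤ L := by
    have h := hL 0 (EuclideanSpace.single 0 1)
    have h1 : ‖(EuclideanSpace.single (0 : Fin 3) (1 : ℝ))‖ ^ 2 = 1 := by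
      rw [EuclideanSpace.single, PiLp.norm_single, norm_one, one_pow]
    rw [h1, mul_one] at h
    exact (abs_nonneg _).trans h
  have hcoef : 0 ≤ c ^ 2 / (2 * a) := by positivity
  refine ⟨Φ, Ψ, G, c, η, Λ, hΦ, hΨ, hG, hΨinv, hGinv, hG0, hGdiv, hΨ', hnorm, hf1, hf2, hf3, hc, hη,
    fun j => ν (j + J), fun j => u₀ (j + J), fun j => u (j + J), fun j => hν _,
    hν0.comp (tendsto_add_atTop_nat J), fun j => hLH _, fun j => hmom _, ⟨E, fun j => hE _⟩,
    fun j => hares _, fun j => ?_⟩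
  -- (b) early relaxation with margin `η` along the tail
  beta_reduce
  set i := j + J with hidef
  have hS1 := detunedWorkIdentity Λ (ν i) c Φ Ψ G (u₀ i) (u i) (hν i) hΦ hΨ hG hΨinv hGinv hG0
    hGdiv hΨ' hnorm (hLH i) (hsup i)
  have hS2 := stub_kickInjectionIdentity Λ (ν i) c Φ χ H G (u₀ i) (u i) (hν i) hΦ hχ hH hG hHinv
    hGinv hG0 hGdiv hH' (hLH i) (hsup i)
  have hS3 := stub_ceilingsYoungBound Λ (ν i) c a Gmax L Φ χ H G (u₀ i) (u i) (hν i) hΦ hχ hH hG hG0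
    hΦnn hχnn hHnn hGmax hL ha hc.le (hLH i) (hsup i)
  -- abbreviations
  set B := Λ.longTimeAvg (fun t => ∫ x, ⟪u i t x - c • EuclideanSpace.single 0 1,
      Torus.convect (fun y => u i t y - c • EuclideanSpace.single 0 1) (fun y => Ψ y • G y) x⟫) with hBdef
  set F := Λ.longTimeAvg (fun t => ∫ x, ⟪Φ x • G x, u i t x⟫) with hFdef
  set A := Λ.longTimeAvg (fun t => ∫ x, ⟪G x, u i t x⟫) with hAdef
  set LΨ := Λ.longTimeAvg (fun t => ∫ x, ⟪u i t x, Torus.laplacian (fun y => Ψ y • G y) x⟫) with hLΨdef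
  set LH' := Λ.longTimeAvg (fun t => ∫ x, ⟪u i t x, Torus.laplacian (fun y => H y • G y) x⟫) with hLHdef
  set Xχ := Λ.longTimeAvg (fun t => ∫ x, χ x * ‖u i t x - c • EuclideanSpace.single 0 1‖ ^ 2) with hXχ
  set XΦ := Λ.longTimeAvg (fun t => ∫ x, Φ x * ‖u i t x - c • EuclideanSpace.single 0 1‖ ^ 2) with hXΦ
  set XH := Λ.longTimeAvg (fun t => ∫ x, H x * ‖u i t x - c • EuclideanSpace.single 0 1‖ ^ 2) with hXH
  set Xb := Λ.longTimeAvg (fun t => ∫ x, ‖u i t x - c • EuclideanSpace.single 0 1‖ ^ 2) with hXb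
  set T1 := Λ.longTimeAvg (fun t => ∫ x, χ x * ⟪G x, u i t x⟫) with hT1
  set T2 := Λ.longTimeAvg (fun t => ∫ x, χ x * ((u i t x - c • EuclideanSpace.single 0 1 : EuclideanSpace ℝ (Fin 3)) 0 * ⟪G x, u i t x⟫))
    with hT2
  set T3 := Λ.longTimeAvg (fun t => ∫ x, Φ x * ((u i t x - c • EuclideanSpace.single 0 1 : EuclideanSpace ℝ (Fin 3)) 0 * ⟪G x, u i t x⟫))
    with hT3
  set T4 := Λ.longTimeAvg (fun t => ∫ x, H x * ⟪u i t x - c • EuclideanSpace.single 0 1,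
      Torus.convect (fun y => u i t y - c • EuclideanSpace.single 0 1) G x⟫) with hT4
  -- ceilings are monotone in the δ's
  have hceil : -(a / 2) * ((∫ x, χ x * ‖G x‖ ^ 2) + ∫ x, ‖G x‖ ^ 2)
        - (c ^ 2 / (2 * a)) * (δχ + δb) - Gmax * (δχ + δΦ) - L * δH
      ≤ -(a / 2) * ((∫ x, χ x * ‖G x‖ ^ 2) + ∫ x, ‖G x‖ ^ 2)
        - (c ^ 2 / (2 * a)) * (Xχ + Xb) - Gmax * (Xχ + XΦ) - L * XH := by
    have h1 := hcχ i; have h2 := hcΦ i; have h3 := hcH i; have h4 := hcb i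
    have e1 : (c ^ 2 / (2 * a)) * (Xχ + Xb) ≤ (c ^ 2 / (2 * a)) * (δχ + δb) :=
      mul_le_mul_of_nonneg_left (by linarith) hcoef
    have e2 : Gmax * (Xχ + XΦ) ≤ Gmax * (δχ + δΦ) := mul_le_mul_of_nonneg_left (by linarith) hGmax0
    have e3 : L * XH ≤ L * δH := mul_le_mul_of_nonneg_left h3 hL0
    linarith
  -- `ν`-terms
  have hν1 : |ν i * LΨ| ≤ ν i * (MΨ * (1 + E) / 2) := by
    rw [abs_mul, abs_of_pos (hν i)]
    exact mul_le_mul_of_nonneg_left (hLΨ i) (hν i).le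
  have hν2 : |ν i * LH'| ≤ ν i * (MH * (1 + E) / 2) := by
    rw [abs_mul, abs_of_pos (hν i)]
    exact mul_le_mul_of_nonneg_left (hLHp i) (hν i).le
  have hν3 : ν i * K ≤ η := hsmall i (Nat.le_add_left J j)
  have hν4 := neg_abs_le (ν i * LΨ)
  have hν5 := neg_abs_le (ν i * LH')
  have hKi : ν i * (MΨ * (1 + E) / 2) + ν i * (MH * (1 + E) / 2) = ν i * K := by
    rw [hKdef]; ring
  -- combine: `B = -c (F - A) - ν LΨ`, `c F = c T1 + T2 - T3 + T4 + ν LH' + ∫ΦH‖G‖²`,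
  -- `-(a/2)(…) - … ≤ c T1 + T2 - T3 + T4 - c A`, `2η ≤ (∫ΦH)‖G‖² - (a/2)(…) - …δ`
  linarith

end Summit.AnomalousDissipation.AnomalousDissipation.Theorems.GridSignsCeilings

end
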